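import Summits.HodgeConjecture.HodgeConjecture.Theorems.Ring2WeilCoverageWeilGramLevel36
import Summits.HodgeConjecture.HodgeConjecture.Theorems.Ring2WeilCoverageCyclotomicSignaturesG6
import HarnessLib

/-!
# Weil-type family coverage — THE COMPONENTS OF THE WEIL-TYPE `ℤ[ζ₃₆]`-SIXFOLDS, II: `θ^i` (`i < 6`) is a `ℚ`-basis of
# `ℚ(ζ₃₆)⁺`; EVERY principal-type `E_ζ′` has Gram determinant `−64` against `i = ζ⁹`; census form and class:
# **the principally polarised Weil-type `ℤ[ζ₃₆]`-CM sixfolds for `ℚ(i)` lie on the SPLIT component** (row R0 for `ℚ(i)`)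

research route conditional on HC_CM; not a corollary; Q11.4-sentence-2 already refuted in dim ≥ 3.

Ring 2, WEIL-TYPE FAMILY-COVERAGE CENSUS (`HOME/WEIL-FAMILY-COVERAGE.md` `## b01`, blocks b01.36 (YES row `(36, ℚ(i))`),
b01.41 (C)), part 110 of the `Ring2WeilCoverage*` series; continues part 109.

* §2 `[ℚ(ζ₃₆)⁺ : ℚ] = 6`; **`1, θ, …, θ⁵` is a `ℚ`-basis of `ℚ(ζ₃₆)⁺`** (Hankel system of part 109).
* §3 **EVERY skew `ζ′` of principal type on `ℤ[ζ₃₆]` gives `det a = −64`** against `i` (THEOREM L (i) at `36`,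
  `norm_realUnits_pos_thirtySix`); CENSUS FORM with `exists_principal_thirtySix_sqrt_neg_one` (part 30′); class
  **`[−64] = splitDiscriminantClass 3 1`**: row R0 for `ℚ(i)` (census W6.1.1) — b02.1 (F3) for these CM points, kernel
  (b01.17's `A′₃₆` is one of them).

HONEST FRAMING as part 109; `HC_CM` is used nowhere.  No `def`, no named fact, no `sorry`.

References: [cite: vanGeemen1994HodgeAV, Lemma 5.2 (2)–(4), 5.4 and (5.4.1)]; [cite: Shimura1998, §14.3 Prop. 4–5,
pp. 103–104]; census b01.36, b01.41 (C) (seat-derived).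
-/

noncomputable section

open Polynomial NumberField Module
open scoped nonZeroDivisors

namespace Summit.HodgeConjecture.Ring2WeilCoverage.WeilGramLevel36Principal

open Literature.AlgebraicGeometry.VanGeemen1994 (weilField weilNormResidueGroup)
open Literature.AlgebraicGeometry.Motives (CMType normUnitsSubgroup)
open Literature.NumberTheory.ComplexMultiplication
open Summit.HodgeConjecture.Ring2WeilCoverage.TraceGramDeterminant (trace_aeval_zeta_mul_inv)
open Summit.HodgeConjecture.Ring2WeilCoverage.WeilGramCMPoint
open Summit.HodgeConjecture.Ring2WeilCoverage.RealUnitNormHalfSystems (complexConj_eq_inv)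
open Summit.HodgeConjecture.Ring2WeilCoverage.CyclotomicPrincipalObstruction (complexConj_xi)
open Summit.HodgeConjecture.Ring2WeilCoverage.CyclotomicDifferent (isOfType_one_xi_top xi_ne_zero)
open Summit.HodgeConjecture.HodgeConjecture.Ring2.WeilCoverage (mk_neg_eq_split_of_odd mk_neg_ne_split_of_odd
  mem_normUnitsSubgroup_of_sq_add_mul_sq)
open Summit.HodgeConjecture.HodgeConjecture.Ring2.Hypotheses (splitDiscriminantClass)
open Summit.HodgeConjecture.Ring2WeilCoverage.WeilGramLevel36
open Summit.HodgeConjecture.Ring2WeilCoverage.CyclotomicUnconditional (norm_realUnits_pos_thirtySix)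
open Summit.HodgeConjecture.Ring2WeilCoverage.CyclotomicSignaturesG6 (exists_principal_thirtySix_sqrt_neg_one)
variable {K : Type} [Field K] [NumberField K] {ζ : K}

/-- `𝐞(t) = exp(2πi t/n) ∈ ℂ` (`ZMod.toCircle`). -/
local notation3 (prettyPrint := false) "𝐞 " t:max => ((ZMod.toCircle t : Circle) : ℂ)

/-- the residue set `S_Φ` read at level `36`. -/
local notation3 (prettyPrint := false) "SΦ[" Φ "," z "]" =>
  (Finset.univ.filter fun t : ZMod 36 => ∃ σ ∈ (Φ : CMType K).1, σ (z : K) = 𝐞 t)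

/-! ### §2 `1, θ, …, θ⁵` is a `ℚ`-basis of `K⁺ = ℚ(ζ₃₆)⁺` -/

/-- `[ℚ(ζ_36)⁺ : ℚ] = 6`. [folklore] -/
theorem finrank_realSubfield [IsCyclotomicExtension {36} ℚ K] [IsCMField K] :
    finrank ℚ (maximalRealSubfield K) = 6 := by
  have h1 : finrank ℚ K = 12 := by
    rw [IsCyclotomicExtension.finrank K (cyclotomic.irreducible_rat (by norm_num : 0 < 36))]; decide
  have h2 := Module.finrank_mul_finrank ℚ (maximalRealSubfield K) K
  rw [Algebra.IsQuadraticExtension.finrank_eq_two (maximalRealSubfield K) K, h1] at h2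
  omega

/-- **`1, θ, …, θ⁵` are `ℚ`-linearly independent in `K⁺`**: a relation `Σ cₖ θ^k = 0`, multiplied by `ζ′ s θ^m` and
traced, gives the Hankel system of §1 (`m ≤ 5`), whose determinant is non-zero.
research route conditional on HC_CM; not a corollary; Q11.4-sentence-2 already refuted in dim ≥ 3. [folklore] -/
theorem linearIndependent_thetaPow [IsCyclotomicExtension {36} ℚ K] [IsCMField K] (hζ : IsPrimitiveRoot ζ 36)
    {ω : Fin 6 → maximalRealSubfield K} (hω : ∀ i, (ω i : K) = (ζ + ζ⁻¹) ^ (i : ℕ)) : LinearIndependent ℚ ω := by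
  rw [Fintype.linearIndependent_iff]
  intro c hc
  have hcK : ∑ i : Fin 6, (c i : K) * (ζ + ζ⁻¹) ^ (i : ℕ) = 0 := by
    have h := congrArg (fun y : maximalRealSubfield K => (y : K)) hc
    simp only [ZeroMemClass.coe_zero] at h
    rw [← h]
    push_cast
    refine Finset.sum_congr rfl fun i _ => ?_
    rw [Rat.smul_def, hω i]
  have E : ∀ m : ℕ, ∑ i : Fin 6, c i * Algebra.trace ℚ K ((ζ ^ 5 * (aeval ζ (derivative (cyclotomic 36 ℚ)))⁻¹) * (ζ ^ 9) *
      (ζ + ζ⁻¹) ^ (m + (i : ℕ))) = 0 := by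
    intro m
    have h := congrArg (fun y => Algebra.trace ℚ K ((ζ ^ 5 * (aeval ζ (derivative (cyclotomic 36 ℚ)))⁻¹) * (ζ ^ 9) * (ζ + ζ⁻¹) ^ m * y)) hcK
    simp only [mul_zero, map_zero, Finset.mul_sum, map_sum] at h
    rw [← h]
    refine Finset.sum_congr rfl fun i _ => ?_
    rw [show (ζ ^ 5 * (aeval ζ (derivative (cyclotomic 36 ℚ)))⁻¹) * (ζ ^ 9) * (ζ + ζ⁻¹) ^ m *
        ((c i : K) * (ζ + ζ⁻¹) ^ (i : ℕ)) = (c i) • ((ζ ^ 5 * (aeval ζ (derivative (cyclotomic 36 ℚ)))⁻¹) * (ζ ^ 9) *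
        (ζ + ζ⁻¹) ^ (m + (i : ℕ))) by rw [Rat.smul_def, pow_add]; ring, map_smul, smul_eq_mul]
  have e0 := E 0
  have e1 := E 1
  have e2 := E 2
  have e3 := E 3
  have e4 := E 4
  have e5 := E 5
  simp only [Fin.sum_univ_six, Fin.isValue, Fin.val_zero, Fin.val_one, Fin.val_two, show ((3 : Fin 6) : ℕ) = 3 from rfl,
    show ((4 : Fin 6) : ℕ) = 4 from rfl, show ((5 : Fin 6) : ℕ) = 5 from rfl,
    Nat.reduceAdd, zero_add, add_zero, pow_zero, mul_one, pow_one, trace_xi_sqrtNegOne_zero hζ, trace_xi_sqrtNegOne_one hζ, trace_xi_sqrtNegOne_two hζ,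
    trace_xi_sqrtNegOne_three hζ, trace_xi_sqrtNegOne_four hζ, trace_xi_sqrtNegOne_five hζ,
    trace_xi_sqrtNegOne_six hζ, trace_xi_sqrtNegOne_seven hζ, trace_xi_sqrtNegOne_eight hζ,
    trace_xi_sqrtNegOne_nine hζ, trace_xi_sqrtNegOne_ten hζ] at e0 e1 e2 e3 e4 e5
  have c0 : c 0 = 0 := by linear_combination ((-21 : ℚ) / 2) * e1 + ((21 : ℚ) / 2) * e3 + (-2 : ℚ) * e5
  have c1 : c 1 = 0 := by linear_combination ((-21 : ℚ) / 2) * e0 + ((21 : ℚ) / 2) * e2 + (-2 : ℚ) * e4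
  have c2 : c 2 = 0 := by linear_combination ((21 : ℚ) / 2) * e1 + ((-25 : ℚ) / 2) * e3 + ((5 : ℚ) / 2) * e5
  have c3 : c 3 = 0 := by linear_combination ((21 : ℚ) / 2) * e0 + ((-25 : ℚ) / 2) * e2 + ((5 : ℚ) / 2) * e4
  have c4 : c 4 = 0 := by linear_combination (-2 : ℚ) * e1 + ((5 : ℚ) / 2) * e3 + ((-1 : ℚ) / 2) * e5
  have c5 : c 5 = 0 := by linear_combination (-2 : ℚ) * e0 + ((5 : ℚ) / 2) * e2 + ((-1 : ℚ) / 2) * e4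
  intro i
  fin_cases i
  · exact c0
  · exact c1
  · exact c2
  · exact c3
  · exact c4
  · exact c5

/-- **A `ℚ`-basis `ωb` of `K⁺ = ℚ(ζ_36)⁺ with `ωb i = θ^i`** (`i < 6`). [folklore] -/
theorem exists_basis_thetaPow [IsCyclotomicExtension {36} ℚ K] [IsCMField K] (hζ : IsPrimitiveRoot ζ 36) :
    ∃ ωb : Basis (Fin 6) ℚ (maximalRealSubfield K), ∀ i, (ωb i : K) = (ζ + ζ⁻¹) ^ (i : ℕ) := by
  let θ' : maximalRealSubfield K :=
    ⟨ζ + ζ⁻¹, (IsCMField.complexConj_eq_self_iff K (ζ + ζ⁻¹)).mp (complexConj_theta hζ)⟩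
  let ω : Fin 6 → maximalRealSubfield K := fun i => θ' ^ (i : ℕ)
  have hω : ∀ i, (ω i : K) = (ζ + ζ⁻¹) ^ (i : ℕ) := fun i => by simp [ω, θ']
  have hli := linearIndependent_thetaPow hζ hω
  have hcard : Fintype.card (Fin 6) = finrank ℚ (maximalRealSubfield K) := by
    rw [Fintype.card_fin, finrank_realSubfield]
  exact ⟨basisOfLinearIndependentOfCardEqFinrank hli hcard, fun i => by
    rw [coe_basisOfLinearIndependentOfCardEqFinrank]; exact hω i⟩

/-! ### §3 Every principal-type parameter gives `−64` against `i`; census form; SPLIT -/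

/-- **For EVERY skew `ζ′` of PRINCIPAL type on `ℤ[ζ_36]` (`IsOfType 1 ζ′ ⊤`; `ζ′ = uξ`, `u` a real unit, `N(u) = 1`
by THEOREM L (i) at `36`) the Gram determinant of `(E_ζ′, i)` in the frame `θ^i` is `-64`** (such `Φ`-positive `ζ′` exist on every `ℚ(i)`-balanced `Φ`, `exists_principal_thirtySix_sqrt_neg_one`): the SPLIT row R0 for `ℚ(i)` (census W6.1.1 `= (3, ℚ(i), 1)`);
`(−1)³ det a > 0`, the right sign for Weil signature `(3,3)` [vG94 5.2 (4)].
research route conditional on HC_CM; not a corollary; Q11.4-sentence-2 already refuted in dim ≥ 3. [cite: vanGeemen1994HodgeAV, Lemma 5.2 (3)–(4) and (5.4.1)] [cite: Shimura1998, §14.3 Prop. 5, p. 104] -/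
theorem det_realPart_principal_sqrtNegOne [IsCyclotomicExtension {36} ℚ K] [IsCMField K]
    (hζ : IsPrimitiveRoot ζ 36) {ζ' : K} (hζ' : IsCMField.complexConj K ζ' = -ζ')
    (hT : CMTypeLattice.IsOfType (1 : (FractionalIdeal (𝓞 K)⁰ K)ˣ) ζ' ⊤)
    {x : Fin 6 → K} (hx : ∀ i, x i = (ζ + ζ⁻¹) ^ (i : ℕ)) {a : Matrix (Fin 6) (Fin 6) ℚ}
    (ha : ∀ i j, a i j = Algebra.trace ℚ K (ζ' * x i * IsCMField.complexConj K ((ζ ^ 9) * x j))) :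
    a.det = -64 := by
  obtain ⟨ωb, hωb⟩ := exists_basis_thetaPow hζ
  have hx' : ∀ i, x i = (ωb i : K) := fun i => (hx i).trans (hωb i).symm
  rw [det_realPart_eq_of_isOfType ωb (complexConj_sqrtNegOne hζ) hx' (norm_realUnits_pos_thirtySix hζ)
    (complexConj_xi_thirtySix hζ) (xi_ne_zero hζ 5) hζ' (isOfType_one_xi_top hζ 5) hT (fun i j => rfl) ha]
  exact det_realPart_xi_sqrtNegOne hζ hx (fun i j => rfl)

open scoped Classical in
/-- **CENSUS FORM** (the YES row `(36, ℚ(√−1))`: existence in the tree + the determinant here): for every CM type `Φ` of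
`ℚ(ζ_36)` balanced for `N_K = {7, 11, 19, 23, 31, 35}`, `ℂ^Φ/Φ(ℤ[ζ_36])` carries a `Φ`-positive divisor of PRINCIPAL type, and EVERY such
divisor has van Geemen Gram determinant `-64` in the real frame `θ^i`: the SPLIT row R0 for `ℚ(i)` (census W6.1.1 `= (3, ℚ(i), 1)`).
research route conditional on HC_CM; not a corollary; Q11.4-sentence-2 already refuted in dim ≥ 3. [cite: vanGeemen1994HodgeAV, Lemma 5.2 (3)–(4) and (5.4.1)] [cite: Shimura1998, §14.3 Prop. 4–5, pp. 103–104] -/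
theorem exists_principal_sqrtNegOne_det [IsCyclotomicExtension {36} ℚ K] [IsCMField K]
    (hζ : IsPrimitiveRoot ζ 36) (Φ : CMType K)
    (hbal : 2 * (SΦ[Φ, ζ] ∩ ({7, 11, 19, 23, 31, 35} : Finset (ZMod 36))).card = (SΦ[Φ, ζ]).card) :
    ∃ ζ' : K, IsCMField.complexConj K ζ' = -ζ' ∧ (∀ φ : Φ.1, 0 < (φ.1 ζ').im) ∧
      CMTypeLattice.IsOfType (1 : (FractionalIdeal (𝓞 K)⁰ K)ˣ) ζ' ⊤ ∧
      ∀ (x : Fin 6 → K), (∀ i, x i = (ζ + ζ⁻¹) ^ (i : ℕ)) → ∀ a : Matrix (Fin 6) (Fin 6) ℚ,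
        (∀ i j, a i j = Algebra.trace ℚ K (ζ' * x i * IsCMField.complexConj K ((ζ ^ 9) * x j))) →
        a.det = -64 := by
  obtain ⟨ζ', h1, h2, h3⟩ := exists_principal_thirtySix_sqrt_neg_one hζ Φ hbal
  exact ⟨ζ', h1, h2, h3, fun x hx a ha => det_realPart_principal_sqrtNegOne hζ h1 h3 hx ha⟩

/-- **`[-64] = [−1]·[64]` is the SPLIT class `splitDiscriminantClass 3 1` in `ℚˣ/Nm(ℚ(√−1)ˣ)`** (`64 = 8² + 1·0² ∈ Nm`):
the principally polarised Weil-type `ℤ[ζ₃₆]`-CM sixfolds for `ℚ(i)` lie on the SPLIT row R0 for `ℚ(i)` (census W6.1.1 `= (3, ℚ(i), 1)`).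
research route conditional on HC_CM; not a corollary; Q11.4-sentence-2 already refuted in dim ≥ 3. [cite: vanGeemen1994HodgeAV, 5.4 and (5.4.1)] -/
theorem mk0_det_principal_sqrtNegOne :
    (QuotientGroup.mk (Units.mk0 (-64 : ℚ) (by norm_num)) : weilNormResidueGroup 1) = splitDiscriminantClass 3 1 :=
  mk_neg_eq_split_of_odd (by decide) (by norm_num : (64 : ℚ) ≠ 0)
    (mem_normUnitsSubgroup_of_sq_add_mul_sq _ (8 : ℚ) (0 : ℚ) (by norm_num))

end Summit.HodgeConjecture.Ring2WeilCoverage.WeilGramLevel36Principal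

end
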